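import Mathlib
import Summits.NavierStokesRegularity.NavierStokesRegularity.Theorems.TypeIQuarterGateScarEnvelopeTypeIZoomDictionaryDefs
import Summits.NavierStokesRegularity.NavierStokesRegularity.Theorems.TypeIQuarterGateScarEnvelopeTypeIFatKill
import Summits.NavierStokesRegularity.NavierStokesRegularity.Theorems.TypeIQuarterGateScarEnvelopeTypeIBudgetViolators
import Summits.NavierStokesRegularity.NavierStokesRegularity.Theorems.TypeIQuarterGateScarEnvelopeTypeIOfNoTwinScarObject
import Summits.NavierStokesRegularity.NavierStokesRegularity.Theorems.TypeIQuarterGateQuarterLawTypeIGlue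
import Summits.NavierStokesRegularity.NavierStokesRegularity.Theorems.TypeIQuarterGateEnvelopeQuarterLaw
import Summits.NavierStokesRegularity.NavierStokesRegularity.Theorems.TypeIQuarterGateScarEnvelopeTypeINearOneRateDss
import Literature.Analysis.FluidPDE.AncientAxisymmetricTypeILiouville
import Literature.Geometry.GeometricMeasureTheory.CurrentsAdmissibleHomotopy
import Summits.NavierStokesRegularity.NavierStokesRegularity.Theorems.TypeIQuarterGateScarEnvelopeTypeIZoomDictionaryLemmas
import Summits.NavierStokesRegularity.NavierStokesRegularity.Theorems.TypeIQuarterGateScarEnvelopeTypeIZoomDictionaryUnitInputs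
import Summits.NavierStokesRegularity.NavierStokesRegularity.Theorems.TypeIQuarterGateScarEnvelopeTypeIZoomDictionaryPersistence

/-!
# Part L0–L2: stability of regular final-time points and the KNSS space–time envelope at a satellite-free point

Part L0–L2 of the ROUND-32 plate («TAME ⟺ ENVELOPED»): elementary lemmas, interior stability of regular final-time points under the zoom convergence, and the KNSS space–time envelope `HasTypeIDecay` at a satellite-free final-time point of a tower object.

PROVENANCE: declaration texts VERBATIM from the HOME plates of the instrument seat nsreg-p3 (g24/g25, cell
`pub/ns-regularity-ideate`): `round-31/Tangent31prep.lean` v5 (sha16 `e5b8668e3a090216`; = ROUND-30 plate v10 + Part K) and,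
for Part L, `round-32/Tangent32prep.lean` v6 (sha16 `6123f27718636121`);
the author cannot write under `Theorems/` (`perm.theorems-prover-only`); landed by the
LEAD-lineage prover ns-sz-p1 g5 on director-ns DIRECTOR-NS #218 (2), split into ≤ 400-line modules (the
plate's `def`s gathered in `TypeIQuarterGateScarEnvelopeTypeIZoomDictionaryDefs`), namespace
`Summit.NavierStokesRegularity.NavierStokesRegularity.Cruxes.ScarEnvelopeTypeI.ZoomDictionary` (the plate's `NsregP3.R30P`), `E3` spelled out, one-line docstrings
added where the plate had none.  `--supports stmt-NavierStokesRegularity-23843 --as helper`.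

HONEST FRAMING: dictionary / census TOOLING for the crux `TypeIQuarterGate.ScarEnvelopeTypeI` (item 23843):
equivalences and normal forms, kernel-checked; NO open statement is proved — 23843, its parent
`QuarterLawTypeI` (23726), the route and Navier–Stokes regularity are OPEN; hard core evaded: none.
-/

-- the summit-side namespace repeats a component by design (single-conjunct summit, D-0017)
set_option linter.dupNamespace false

open MeasureTheory Set Metric Filter Topology
open scoped ENNReal

namespace Summit.NavierStokesRegularity.NavierStokesRegularity.Cruxes.ScarEnvelopeTypeI.ZoomDictionary

variable {u : ℝ → (EuclideanSpace ℝ (Fin 3)) → (EuclideanSpace ℝ (Fin 3))} {a : (EuclideanSpace ℝ (Fin 3))} {ν T : ℝ}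

section Tower

open Literature.Analysis.FluidPDE
variable {U : ℝ → (EuclideanSpace ℝ (Fin 3)) → (EuclideanSpace ℝ (Fin 3))} {P : ℝ → (EuclideanSpace ℝ (Fin 3)) → ℝ} {y' : (EuclideanSpace ℝ (Fin 3))} {ν : ℝ}
open Summit.NavierStokesRegularity.NavierStokesRegularity.Cruxes.ScarEnvelopeTypeI.ScarZoom
  (CruxHypotheses ScarViolators TwinScarObject singularAt_of_isBackwardSingularPoint
    exists_localEnergy_of_typeIBound) in

/-! #### L0. Two elementary lemmas -/

/-- A continuous function a.e. dominated by a continuous function on an open set is dominated there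
pointwise. -/
theorem norm_le_of_ae_le_of_continuousOn {f : ℝ × (EuclideanSpace ℝ (Fin 3)) → (EuclideanSpace ℝ (Fin 3))} {g : ℝ × (EuclideanSpace ℝ (Fin 3)) → ℝ} {O : Set (ℝ × (EuclideanSpace ℝ (Fin 3)))}
    (hO : IsOpen O) (hf : ContinuousOn f O) (hg : ContinuousOn g O)
    (h : ∀ᵐ z ∂(volume.restrict O), ‖f z‖ ≤ g z) : ∀ z ∈ O, ‖f z‖ ≤ g z := by
  by_contra hcon
  push Not at hcon
  obtain ⟨z, hzO, hzg⟩ := hcon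
  set V : Set (ℝ × (EuclideanSpace ℝ (Fin 3))) := O ∩ (fun w => ‖f w‖ - g w) ⁻¹' Ioi 0 with hV
  have hVopen : IsOpen V := (hf.norm.sub hg).isOpen_inter_preimage hO isOpen_Ioi
  have hzV : z ∈ V := ⟨hzO, sub_pos.2 hzg⟩
  have hpos : 0 < volume V := hVopen.measure_pos volume ⟨z, hzV⟩
  have hnull : volume V = 0 := by
    have h' : ∀ᵐ w ∂volume, w ∈ O → ‖f w‖ ≤ g w := (ae_restrict_iff' hO.measurableSet).1 h
    have h0 : volume {w | ¬ (w ∈ O → ‖f w‖ ≤ g w)} = 0 := ae_iff.1 h'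
    refine measure_mono_null (fun w hw => ?_) h0
    simp only [mem_setOf_eq]
    exact fun himp => absurd (himp hw.1) (not_le.2 (sub_pos.1 hw.2))
  exact absurd hnull hpos.ne'

/-! #### L1. Stability of regular final-time points, interior form -/

/-- **Stability of regular final-time points (interior form).** If `ū` is a tangent flow of `u` at
`(a, T)` along `L` and `(0, z)`, `‖z‖ < 1`, is a regular final-time point of `ū`, then the zooms
`u^{(L_k)}` are eventually uniformly bounded POINTWISE on a backward cylinder about `(0, z)`
(`persistenceU_holds`, A–B Prop. 2.3 one level down, on `Q_ρ(0,z) ⊆ Q_R(0)`, `R = (1+‖z‖)/2`;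
continuity of `u` below `T` turns the essential bound into a pointwise one). -/
theorem zoom_eventually_bdd_of_regPt {u : ℝ → (EuclideanSpace ℝ (Fin 3)) → (EuclideanSpace ℝ (Fin 3))} {p : ℝ → (EuclideanSpace ℝ (Fin 3)) → ℝ} {a : (EuclideanSpace ℝ (Fin 3))} {T : ℝ}
    (hT : 0 < T) (hcont : ContinuousOn (Function.uncurry u) (Ioo 0 T ×ˢ univ))
    (hZ : ZoomsInBall u p a T) (hB : ZoomsBddU u p a T) {L : ℕ → ℝ} {ū : ℝ → (EuclideanSpace ℝ (Fin 3)) → (EuclideanSpace ℝ (Fin 3))}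
    (ht : TangentU u p a T L ū) {z : (EuclideanSpace ℝ (Fin 3))} (hz : ‖z‖ < 1) (hreg : RegPt ū z) :
    ∃ ρ : ℝ, 0 < ρ ∧ ∃ A : ℝ, ∀ᶠ k in atTop,
      ∀ s ∈ Ioo (-(ρ ^ 2)) 0, ∀ w ∈ ball z ρ, ‖zoom u a T (L k) s w‖ ≤ A := by
  obtain ⟨hpos, hlim, pbar, hR⟩ := ht
  set R : ℝ := (1 + ‖z‖) / 2 with hRdef
  have hR0 : 0 < R := by rw [hRdef]; positivity
  have hR1 : R < 1 := by rw [hRdef]; linarith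
  obtain ⟨hIBū, -, hconv, hweak⟩ := hR R ⟨hR0, hR1⟩
  obtain ⟨L₁, hL₁, hS⟩ := hZ
  obtain ⟨C, hC, L₂, hL₂, hBd⟩ := hB
  obtain ⟨k₀, hk₀⟩ : ∃ k₀, ∀ k ≥ k₀, L k ≤ min L₁ L₂ :=
    eventually_atTop.1 (hlim.eventually (Iic_mem_nhds (lt_min hL₁ hL₂)))
  set ρ : ℝ := (1 - ‖z‖) / 2 with hρdef
  have hρpos : 0 < ρ := by rw [hρdef]; linarith
  set Acyl : Set (ℝ × (EuclideanSpace ℝ (Fin 3))) := parabolicCylinder ρ ((0 : ℝ), z) with hAcyl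
  have hA2 : Acyl ⊆ parabolicCylinder R (0 : ℝ × (EuclideanSpace ℝ (Fin 3))) :=
    parabolicCylinder_subset_zero
      (pow_le_pow_left₀ hρpos.le (by rw [hρdef, hRdef]; linarith [norm_nonneg z]) 2)
      (by rw [hρdef, hRdef]; linarith)
  have hA1 : Acyl ⊆ parabolicCylinder 1 (0 : ℝ × (EuclideanSpace ℝ (Fin 3))) :=
    hA2.trans (parabolicCylinder_mono hR0.le hR1.le _)
  have hAm : MeasurableSet Acyl := measurableSet_parabolicCylinder' _ _
  -- the shifted approximating sequence
  set v : ℕ → ℝ → (EuclideanSpace ℝ (Fin 3)) → (EuclideanSpace ℝ (Fin 3)) := fun k => zoom u a T (L (k + k₀)) with hv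
  set q : ℕ → ℝ → (EuclideanSpace ℝ (Fin 3)) → ℝ := fun k => zoomP p a T (L (k + k₀)) with hq
  have hk : ∀ k, L (k + k₀) ≤ min L₁ L₂ := fun k => hk₀ _ (Nat.le_add_left k₀ k)
  have h1 : ∀ k, IsSuitableWeakSolutionInBall ρ ((0 : ℝ), z) (v k) (q k) := fun k =>
    (hS _ (hpos _) ((hk k).trans (min_le_left _ _))).of_subset_zero hρpos hA1
  have h2 : IsSuitableWeakSolutionInBall ρ ((0 : ℝ), z) ū pbar := hIBū.of_subset_zero hρpos hA2
  have hμ1 : volume.restrict Acyl ≤ volume.restrict (parabolicCylinder 1 (0 : ℝ × (EuclideanSpace ℝ (Fin 3)))) :=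
    Measure.restrict_mono hA1 le_rfl
  have hμ2 : volume.restrict Acyl ≤ volume.restrict (parabolicCylinder R (0 : ℝ × (EuclideanSpace ℝ (Fin 3)))) :=
    Measure.restrict_mono hA2 le_rfl
  have h3 : (⨆ k, eLpNorm (Function.uncurry (v k)) 3 (volume.restrict Acyl) +
      eLpNorm (Function.uncurry (q k)) (3 / 2) (volume.restrict Acyl)) < ⊤ := by
    refine lt_of_le_of_lt (iSup_le fun k => ?_) hC
    exact (add_le_add (eLpNorm_mono_measure _ hμ1) (eLpNorm_mono_measure _ hμ1)).trans
      (hBd _ (hpos _) ((hk k).trans (min_le_right _ _)))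
  have h4 : Tendsto (fun k => eLpNorm (Function.uncurry (v k) - Function.uncurry ū) 3
      (volume.restrict Acyl)) atTop (𝓝 0) := by
    have h := hconv.comp (tendsto_add_atTop_nat k₀)
    exact tendsto_of_tendsto_of_tendsto_of_le_of_le tendsto_const_nhds h (fun _ => zero_le)
      (fun k => eLpNorm_mono_measure _ hμ2)
  have h5 : ∀ g : ℝ × (EuclideanSpace ℝ (Fin 3)) → ℝ, MemLp g 3 (volume.restrict Acyl) →
      Tendsto (fun k => ∫ w in Acyl, q k w.1 w.2 * g w) atTop
        (𝓝 (∫ w in Acyl, pbar w.1 w.2 * g w)) := by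
    intro g hg
    have hg' : MemLp (Acyl.indicator g) 3 (volume.restrict (parabolicCylinder R (0 : ℝ × (EuclideanSpace ℝ (Fin 3))))) := by
      rw [memLp_indicator_iff_restrict hAm, Measure.restrict_restrict hAm, inter_eq_left.2 hA2]
      exact hg
    have key : ∀ f : ℝ × (EuclideanSpace ℝ (Fin 3)) → ℝ,
        ∫ w in parabolicCylinder R (0 : ℝ × (EuclideanSpace ℝ (Fin 3))), f w * Acyl.indicator g w =
          ∫ w in Acyl, f w * g w := by
      intro f
      have : (fun w => f w * Acyl.indicator g w) = Acyl.indicator (fun w => f w * g w) := by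
        funext w; by_cases hw : w ∈ Acyl <;> simp [hw]
      rw [this, setIntegral_indicator hAm, inter_eq_right.2 hA2]
    have h := (hweak _ hg').comp (tendsto_add_atTop_nat k₀)
    rw [key] at h
    refine (h.congr fun k => ?_)
    exact key _
  obtain ⟨r, hr, M, hM⟩ := persistenceU_holds v q ū pbar z ρ hρpos h1 h2 h3 h4 h5 hreg
  refine ⟨r, hr, M, ?_⟩
  have hlim' : Tendsto (fun k => L (k + k₀)) atTop (𝓝 0) := hlim.comp (tendsto_add_atTop_nat k₀)
  have hev : ∀ᶠ k in atTop, ∀ s ∈ Ioo (-(r ^ 2)) 0, ∀ w ∈ ball z r,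
      ‖zoom u a T (L (k + k₀)) s w‖ ≤ M := by
    filter_upwards [hM, eventually_sq_mul_lt hlim' hT (r ^ 2)] with k hk hkT
    have hcz : ContinuousOn (Function.uncurry (v k)) ((Ioo (-(r ^ 2)) 0 ×ˢ ball z r)) :=
      continuousOn_zoom hcont (hpos (k + k₀)) z hkT
    have hk' : ∀ᵐ w ∂(volume.restrict ((Ioo (-(r ^ 2)) 0 ×ˢ ball z r))), ‖Function.uncurry (v k) w‖ ≤ M := by
      rw [Ioo_prod_ball_eq_parabolicCylinder]; exact hk
    have hpt := norm_le_of_ae_of_continuousOn ((isOpen_Ioo.prod isOpen_ball)) hcz hk'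
    intro s hs w hw
    exact hpt (s, w) ⟨hs, hw⟩
  exact eventually_of_shift (P := fun k => ∀ s ∈ Ioo (-(r ^ 2)) 0, ∀ w ∈ ball z r,
      ‖zoom u a T (L k) s w‖ ≤ M) hev

/-! #### L2. The KNSS space–time envelope at a satellite-free final-time point -/

/-- **SATELLITE-FREE ⇒ ENVELOPED.** Let `u` be continuous on `(0,T) × ℝ³` with the sup-norm Type-I
rate on a final window, with small zooms at `(a, T)` in A–B's class and bounded in `L³ × L^{3/2}`,
and suppose EVERY tangent flow of `u` at `(a, T)` is regular at every final-time point `(0, z)`,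
`0 < ‖z‖ < 1`.  Then `u` obeys the space–time Type-I envelope at `(a, T)`:
`‖u(t,x)‖ ≤ A/(‖x − a‖ + √(T − t))` for `t ∈ (T − δ², T)`, `x ∈ B(a, δ)`.
Proof: otherwise there are `(t_k, x_k) → (T, a)` with `(‖x_k − a‖ + √(T − t_k))‖u(t_k,x_k)‖ > k+1`;
the rate forces `√(T − t_k) ≤ C (‖x_k − a‖ + √(T − t_k))/(k+1)`; zooming by
`L_k = 4(‖x_k − a‖ + √(T − t_k))` puts `(t_k, x_k)` at `(s_k, w_k)` with `s_k → 0⁻`, `‖w_k‖ → 1/4`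
and zoom value `> 4(k+1)`; a subsequence of `w_k` converges to `z`, `‖z‖ = 1/4`, a further one has
a tangent flow (I1), regular at `z` by hypothesis, and L1 bounds the zooms near `(0, z)` —
contradiction. -/
theorem envelope_of_noSatellite {u : ℝ → (EuclideanSpace ℝ (Fin 3)) → (EuclideanSpace ℝ (Fin 3))} {p : ℝ → (EuclideanSpace ℝ (Fin 3)) → ℝ} {a : (EuclideanSpace ℝ (Fin 3))} {T : ℝ}
    (hT : 0 < T) (hcont : ContinuousOn (Function.uncurry u) (Ioo 0 T ×ˢ univ))
    {C δ₀ : ℝ} (hδ₀ : 0 < δ₀)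
    (hrate : ∀ t ∈ Ioo (T - δ₀) T, ∀ x, Real.sqrt (T - t) * ‖u t x‖ ≤ C)
    (hZ : ZoomsInBall u p a T) (hB : ZoomsBddU u p a T)
    (hN : ∀ L ū, TangentU u p a T L ū → ∀ z : (EuclideanSpace ℝ (Fin 3)), z ≠ 0 → ‖z‖ < 1 → RegPt ū z) :
    ∃ A δ : ℝ, 0 < δ ∧ ∀ t ∈ Ioo (T - δ ^ 2) T, ∀ x ∈ ball a δ,
      ‖u t x‖ ≤ A / (‖x - a‖ + Real.sqrt (T - t)) := by
  by_contra hcon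
  push Not at hcon
  -- ## the violating sequence
  set ε : ℝ := min 1 δ₀ with hεdef
  have hε0 : 0 < ε := lt_min one_pos hδ₀
  have hε1 : ε ≤ 1 := min_le_left _ _
  have hεδ : ε ≤ δ₀ := min_le_right _ _
  set δ : ℕ → ℝ := fun k => ε / ((k : ℝ) + 1) with hδdef
  have hδpos : ∀ k, 0 < δ k := fun k => by positivity
  have hδle : ∀ k, δ k ≤ ε := fun k =>
    div_le_self hε0.le (by linarith [(Nat.cast_nonneg k : (0 : ℝ) ≤ k)])
  have hδlim : Tendsto δ atTop (𝓝 0) := Literature.Geometry.GeometricMeasureTheory.tendsto_const_div_add_one ε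
  have hex : ∀ k : ℕ, ∃ t ∈ Ioo (T - δ k ^ 2) T, ∃ x ∈ ball a (δ k),
      ((k : ℝ) + 1) / (‖x - a‖ + Real.sqrt (T - t)) < ‖u t x‖ := fun k => hcon _ _ (hδpos k)
  choose t ht x hx hbig using hex
  have hTt : ∀ k, 0 < T - t k := fun k => sub_pos.2 (ht k).2
  have hsq : ∀ k, 0 < Real.sqrt (T - t k) := fun k => Real.sqrt_pos.2 (hTt k)
  set d : ℕ → ℝ := fun k => ‖x k - a‖ + Real.sqrt (T - t k) with hddef
  have hdpos : ∀ k, 0 < d k := fun k => add_pos_of_nonneg_of_pos (norm_nonneg _) (hsq k)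
  have hbig' : ∀ k : ℕ, ((k : ℝ) + 1) < d k * ‖u (t k) (x k)‖ := fun k => by
    have h := hbig k
    rwa [div_lt_iff₀ (hdpos k), mul_comm] at h
  -- `t_k` lies in the rate window
  have htwin : ∀ k, t k ∈ Ioo (T - δ₀) T := fun k => by
    refine ⟨?_, (ht k).2⟩
    have h1 := (ht k).1
    have h2 : δ k ^ 2 ≤ δ₀ :=
      calc δ k ^ 2 ≤ ε ^ 2 := pow_le_pow_left₀ (hδpos k).le (hδle k) 2
        _ ≤ ε := by nlinarith
        _ ≤ δ₀ := hεδ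
    linarith
  -- ## the rate pushes the points outside the parabola: `√(T - t_k)/d_k ≤ C/(k+1)`
  have hratio : ∀ k : ℕ, Real.sqrt (T - t k) / d k ≤ C / ((k : ℝ) + 1) := fun k => by
    rw [div_le_div_iff₀ (hdpos k) (by positivity)]
    calc Real.sqrt (T - t k) * ((k : ℝ) + 1)
        ≤ Real.sqrt (T - t k) * (d k * ‖u (t k) (x k)‖) :=
          mul_le_mul_of_nonneg_left (hbig' k).le (hsq k).le
      _ = d k * (Real.sqrt (T - t k) * ‖u (t k) (x k)‖) := by ring
      _ ≤ d k * C := mul_le_mul_of_nonneg_left (hrate (t k) (htwin k) (x k)) (hdpos k).le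
      _ = C * d k := mul_comm _ _
  have hratio0 : ∀ k, 0 ≤ Real.sqrt (T - t k) / d k := fun k =>
    div_nonneg (Real.sqrt_nonneg _) (hdpos k).le
  -- ## scales, rescaled times and points
  set Ls : ℕ → ℝ := fun k => 4 * d k with hLsdef
  have hLspos : ∀ k, 0 < Ls k := fun k => mul_pos (by norm_num) (hdpos k)
  set w : ℕ → (EuclideanSpace ℝ (Fin 3)) := fun k => (Ls k)⁻¹ • (x k - a) with hwdef
  set s : ℕ → ℝ := fun k => -((T - t k) / Ls k ^ 2) with hsdef
  have hzoom : ∀ k, zoom u a T (Ls k) (s k) (w k) = Ls k • u (t k) (x k) := fun k => by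
    have hL := (hLspos k).ne'
    show Ls k • u (T + Ls k ^ 2 * (-((T - t k) / Ls k ^ 2))) (a + Ls k • (Ls k)⁻¹ • (x k - a)) = _
    congr 2
    · field_simp
      ring
    · rw [smul_smul, mul_inv_cancel₀ hL, one_smul]
      abel
  have hbigzoom : ∀ k : ℕ, 4 * ((k : ℝ) + 1) < ‖zoom u a T (Ls k) (s k) (w k)‖ := fun k => by
    rw [hzoom, norm_smul, Real.norm_of_nonneg (hLspos k).le]
    calc 4 * ((k : ℝ) + 1) < 4 * (d k * ‖u (t k) (x k)‖) :=
          mul_lt_mul_of_pos_left (hbig' k) (by norm_num)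
      _ = Ls k * ‖u (t k) (x k)‖ := by simp only [hLsdef]; ring
  have hw_eq : ∀ k, ‖w k‖ = 1 / 4 - Real.sqrt (T - t k) / d k / 4 := fun k => by
    have hd := (hdpos k).ne'
    show ‖(Ls k)⁻¹ • (x k - a)‖ = _
    rw [norm_smul, norm_inv, Real.norm_of_nonneg (hLspos k).le,
      show ‖x k - a‖ = d k - Real.sqrt (T - t k) by simp only [hddef]; ring]
    show (4 * d k)⁻¹ * (d k - Real.sqrt (T - t k)) = _
    field_simp
  have hw_le : ∀ k, ‖w k‖ ≤ 1 / 4 := fun k => by rw [hw_eq]; linarith [hratio0 k]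
  have hw_ge : ∀ k : ℕ, 1 / 4 - C / ((k : ℝ) + 1) / 4 ≤ ‖w k‖ := fun k => by
    rw [hw_eq]; linarith [hratio k]
  have hs_neg : ∀ k, s k < 0 := fun k =>
    neg_neg_of_pos (div_pos (hTt k) (pow_pos (hLspos k) 2))
  have hs_ge : ∀ k : ℕ, -((C / ((k : ℝ) + 1)) ^ 2 / 16) ≤ s k := fun k => by
    have hd := (hdpos k).ne'
    have h2 : (Real.sqrt (T - t k) / d k) ^ 2 ≤ (C / ((k : ℝ) + 1)) ^ 2 :=
      pow_le_pow_left₀ (hratio0 k) (hratio k) 2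
    have hs_eq : s k = -((Real.sqrt (T - t k) / d k) ^ 2 / 16) := by
      show -((T - t k) / (4 * d k) ^ 2) = _
      rw [div_pow, Real.sq_sqrt (hTt k).le]
      field_simp
      ring
    rw [hs_eq]
    linarith
  -- ## limits: `s_k → 0⁻`, `‖w_k‖ → 1/4`, `L_k → 0`
  have hCk : Tendsto (fun k : ℕ => C / ((k : ℝ) + 1)) atTop (𝓝 0) := Literature.Geometry.GeometricMeasureTheory.tendsto_const_div_add_one C
  have hs0 : Tendsto s atTop (𝓝 0) := by
    have hlow : Tendsto (fun k : ℕ => -((C / ((k : ℝ) + 1)) ^ 2 / 16)) atTop (𝓝 0) := by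
      have h := ((hCk.pow 2).div_const 16).neg
      simpa using h
    exact tendsto_of_tendsto_of_tendsto_of_le_of_le hlow tendsto_const_nhds hs_ge
      (fun k => (hs_neg k).le)
  have hw4 : Tendsto (fun k => ‖w k‖) atTop (𝓝 (1 / 4)) := by
    have hl : Tendsto (fun k : ℕ => 1 / 4 - C / ((k : ℝ) + 1) / 4) atTop (𝓝 (1 / 4)) := by
      have h := (hCk.div_const 4).const_sub (1 / 4)
      simpa using h
    exact tendsto_of_tendsto_of_tendsto_of_le_of_le hl tendsto_const_nhds hw_ge hw_le
  have hd0 : Tendsto d atTop (𝓝 0) := by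
    have hdle : ∀ k, d k ≤ 2 * δ k := fun k => by
      have h1 : ‖x k - a‖ < δ k := by rw [← dist_eq_norm]; exact hx k
      have h2 : Real.sqrt (T - t k) < δ k := by
        rw [Real.sqrt_lt' (hδpos k)]
        linarith [(ht k).1]
      show ‖x k - a‖ + Real.sqrt (T - t k) ≤ 2 * δ k
      linarith
    have h2δ : Tendsto (fun k => 2 * δ k) atTop (𝓝 0) := by simpa using hδlim.const_mul 2
    exact tendsto_of_tendsto_of_tendsto_of_le_of_le tendsto_const_nhds h2δ
      (fun k => (hdpos k).le) hdle
  have hLs0 : Tendsto Ls atTop (𝓝 0) := by simpa [hLsdef] using hd0.const_mul 4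
  -- ## compactness of the rescaled points: `w (φ k) → z`, `‖z‖ = 1/4`
  obtain ⟨z, -, φ, hφ, hwz⟩ := (isCompact_closedBall (0 : (EuclideanSpace ℝ (Fin 3))) (1 / 4)).tendsto_subseq
    (x := w) (fun k => mem_closedBall_zero_iff.2 (hw_le k))
  have hz4 : ‖z‖ = 1 / 4 := tendsto_nhds_unique hwz.norm (hw4.comp hφ.tendsto_atTop)
  have hz0 : z ≠ 0 := by
    intro h
    rw [h, norm_zero] at hz4
    norm_num at hz4
  have hz1 : ‖z‖ < 1 := by rw [hz4]; norm_num
  -- ## a tangent flow along a further subsequence (I1), regular at `z` by hypothesis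
  have hc₀ := c₀_pos.ne'
  obtain ⟨ψ, hψ, ū, hū⟩ := i1_of_suitableCompactness hZ hB (fun k => Ls (φ k) / c₀)
    (fun k => div_pos (hLspos _) c₀_pos)
    (by simpa using (hLs0.comp hφ.tendsto_atTop).div_const c₀)
  have e : (fun k => c₀ * ((fun k => Ls (φ k) / c₀) ∘ ψ) k) = fun k => Ls (φ (ψ k)) := by
    funext k
    simp only [Function.comp_apply]
    field_simp
  have hū' : TangentU u p a T (fun k => Ls (φ (ψ k))) ū := by
    have h : TangentU u p a T (fun k => c₀ * ((fun k => Ls (φ k) / c₀) ∘ ψ) k) ū := hū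
    rwa [e] at h
  have hreg : RegPt ū z := hN _ _ hū' z hz0 hz1
  obtain ⟨ρ, hρ, A, hev⟩ := zoom_eventually_bdd_of_regPt hT hcont hZ hB hū' hz1 hreg
  -- ## along `φ ∘ ψ`: `s → 0⁻`, `w → z`, while the zoom values exceed `4(k+1)` — contradiction
  have hφψ : Tendsto (fun k => φ (ψ k)) atTop atTop := hφ.tendsto_atTop.comp hψ.tendsto_atTop
  have h_s : ∀ᶠ k in atTop, s (φ (ψ k)) ∈ Ioo (-(ρ ^ 2)) 0 := by
    have hneg : -(ρ ^ 2) < 0 := by simpa using pow_pos hρ 2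
    have h1 : ∀ᶠ k in atTop, s (φ (ψ k)) ∈ Ioi (-(ρ ^ 2)) :=
      (hs0.comp hφψ).eventually_mem (Ioi_mem_nhds hneg)
    filter_upwards [h1] with k hk
    exact ⟨hk, hs_neg _⟩
  have h_w : ∀ᶠ k in atTop, w (φ (ψ k)) ∈ ball z ρ :=
    (hwz.comp hψ.tendsto_atTop).eventually_mem (ball_mem_nhds z hρ)
  have h_A : ∀ᶠ k in atTop, A < 4 * (((φ (ψ k) : ℕ) : ℝ) + 1) := by
    have h1 : Tendsto (fun k => 4 * (((φ (ψ k) : ℕ) : ℝ) + 1)) atTop atTop := by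
      refine Tendsto.const_mul_atTop (by norm_num) ?_
      exact Filter.tendsto_atTop_add_const_right _ 1 (tendsto_natCast_atTop_atTop.comp hφψ)
    exact h1.eventually_gt_atTop A
  obtain ⟨k, hk1, hk2, hk3, hk4⟩ := (hev.and (h_s.and (h_w.and h_A))).exists
  have h1 := hk1 _ hk2 _ hk3
  have h2 := hbigzoom (φ (ψ k))
  linarith

end Tower

end Summit.NavierStokesRegularity.NavierStokesRegularity.Cruxes.ScarEnvelopeTypeI.ZoomDictionary
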